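/-
Copyright (c) 2026. All rights reserved.
Released under Apache 2.0 license as described in the file LICENSE.
Authors: abc-iut cell, seat abc-iut-L4-t15 (gen 6).
-/
import Mathlib.GroupTheory.FiniteAbelian.Basic
import Mathlib.GroupTheory.Schreier
import Mathlib.GroupTheory.QuotientGroup.Basic
import Mathlib.GroupTheory.Commutator.Basic
import Mathlib.Topology.Algebra.Group.Basic
import Mathlib.Tactic.Group

/-!
# Finitely generated groups with an abelian torsion subgroup of finite index are finite;
# subgroups of finite index over a closed subgroup are closed

Two elementary finiteness/closedness tools (used for the openness half of the strong-completeness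
reduction for `p`-group-by-metacyclic profinite groups, cell abc-iut, GAP-LEDGER G-L3d2g2-1):

* `finiteIndex_subgroupOf_closure_sup` — let `A ≤ H` be normal subgroups of `G` such that `H/A` is
  abelian (`⁅x, y⁆ ∈ A` for `x, y ∈ H`) of exponent dividing `N ≠ 0` (`x ^ N ∈ A`).  If
  `K = ⟨F⟩ ⊔ A` for a finite set `F` and `H ∩ K` has finite index in `K`, then `A` has finite index in
  `K`: the finitely generated group `K/A` has the finite-index subgroup `(H ∩ K)/A`, finitely generated
  by Schreier's lemma, abelian and torsion, hence finite (Mathlib `CommGroup.finite_of_fg_torsion`);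
* `isClosed_of_finiteIndex_subgroupOf` — in a topological group, a subgroup containing a CLOSED
  subgroup as a subgroup of finite index is closed (finite union of closed cosets).

Mathlib-only, no definitions, no instances. [cite: DDMSAnalyticProP1999, §1.2]
-/

namespace Literature.GroupTheory

open scoped commutatorElement Pointwise IsMulCommutative

variable {G : Type*} [Group G]

/-! ### Finite index from finite generation, an abelian torsion subgroup of finite index -/

/-- **`⟨F⟩A / A` is finite when it is virtually (abelian of finite exponent).**  Let `A ⊴ G` and `H ≤ G`
be subgroups with `⁅H, H⁆ ≤ A` and `x ^ N ∈ A` for all `x ∈ H` (`N ≠ 0`); let `K = closure F ⊔ A` with `F`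
finite, and suppose `H ∩ K` has finite index in `K`.  Then `A` has finite index in `K`.
[cite: DDMSAnalyticProP1999, §1.2] -/
theorem finiteIndex_subgroupOf_closure_sup (A H : Subgroup G) [hA : A.Normal]
    (hcomm : ∀ x ∈ H, ∀ y ∈ H, ⁅x, y⁆ ∈ A) {N : ℕ} (hN : N ≠ 0)
    (hpow : ∀ x ∈ H, x ^ N ∈ A) (F : Finset G)
    (hHK : (H.subgroupOf (Subgroup.closure (F : Set G) ⊔ A)).FiniteIndex) :
    (A.subgroupOf (Subgroup.closure (F : Set G) ⊔ A)).FiniteIndex := by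
  classical
  set K : Subgroup G := Subgroup.closure (F : Set G) ⊔ A with hK
  haveI hAKn : (A.subgroupOf K).Normal := Subgroup.normal_subgroupOf
  let Kq := K ⧸ A.subgroupOf K
  let mk : K →* Kq := QuotientGroup.mk' (A.subgroupOf K)
  have hmk : Function.Surjective mk := QuotientGroup.mk'_surjective _
  have hkerA : ∀ x : K, (x : G) ∈ A → mk x = 1 := fun x hx => by
    rw [QuotientGroup.mk'_apply, QuotientGroup.eq_one_iff]; exact Subgroup.mem_subgroupOf.mpr hx
  -- `Kq` is generated by the (finite) image of `F`
  have hFK : ∀ x ∈ F, x ∈ K := fun x hx => Subgroup.mem_sup_left (Subgroup.subset_closure hx)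
  let Fbar : Finset Kq := F.attach.image fun x => mk ⟨x.1, hFK x.1 x.2⟩
  have hgen : Subgroup.closure (Fbar : Set Kq) = ⊤ := by
    -- every `c ∈ closure F` has its class in `closure Fbar`
    have key : ∀ c ∈ Subgroup.closure (F : Set G), ∀ hcK : c ∈ K,
        mk ⟨c, hcK⟩ ∈ Subgroup.closure (Fbar : Set Kq) := by
      intro c hc
      induction hc using Subgroup.closure_induction with
      | mem x hx =>
        intro hxK
        exact Subgroup.subset_closure (Finset.mem_image.mpr ⟨⟨x, hx⟩, Finset.mem_attach _ _, rfl⟩)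
      | one =>
        intro h1K
        have : (⟨1, h1K⟩ : K) = 1 := rfl
        rw [this, map_one]; exact Subgroup.one_mem _
      | mul x y hx hy ihx ihy =>
        intro hxyK
        have hxK : x ∈ K := Subgroup.mem_sup_left hx
        have hyK : y ∈ K := Subgroup.mem_sup_left hy
        have h1 : (⟨x * y, hxyK⟩ : K) = ⟨x, hxK⟩ * ⟨y, hyK⟩ := rfl
        rw [h1, map_mul]
        exact Subgroup.mul_mem _ (ihx hxK) (ihy hyK)
      | inv x hx ihx =>
        intro hxK'
        have hxK : x ∈ K := Subgroup.mem_sup_left hx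
        have h1 : (⟨x⁻¹, hxK'⟩ : K) = (⟨x, hxK⟩ : K)⁻¹ := rfl
        rw [h1, map_inv]
        exact Subgroup.inv_mem _ (ihx hxK)
    rw [eq_top_iff]
    rintro q -
    obtain ⟨⟨k, hk⟩, rfl⟩ := hmk q
    -- `k ∈ closure F ⊔ A = closure F * A`
    have hk' : k ∈ ((Subgroup.closure (F : Set G) ⊔ A : Subgroup G) : Set G) := hk
    rw [Subgroup.mul_normal] at hk'
    obtain ⟨c, hc, a, ha, rfl⟩ := Set.mem_mul.mp hk'
    have hcK : c ∈ K := Subgroup.mem_sup_left hc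
    have : mk ⟨c * a, hk⟩ = mk ⟨c, hcK⟩ := by
      have h1 : (⟨c * a, hk⟩ : K) = ⟨c, hcK⟩ * ⟨a, Subgroup.mem_sup_right ha⟩ := rfl
      rw [h1, map_mul, hkerA ⟨a, _⟩ ha, mul_one]
    rw [this]
    exact key c hc hcK
  haveI : Group.FG Kq := Group.fg_iff.mpr ⟨Fbar, hgen, Fbar.finite_toSet⟩
  -- the image of `H ∩ K` in `Kq`: finite index, abelian, torsion
  let Hq : Subgroup Kq := (H.subgroupOf K).map mk
  haveI hHqfi : Hq.FiniteIndex := by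
    refine ⟨fun h0 => hHK.index_ne_zero ?_⟩
    have := Subgroup.index_map_dvd (H.subgroupOf K) hmk
    rw [h0] at this
    exact Nat.eq_zero_of_zero_dvd this
  haveI : Group.FG Hq := Subgroup.fg_of_index_ne_zero Hq
  haveI hHqc : IsMulCommutative Hq := by
    refine ⟨⟨fun a b => ?_⟩⟩
    obtain ⟨_, ⟨x, hx, rfl⟩⟩ := a
    obtain ⟨_, ⟨y, hy, rfl⟩⟩ := b
    apply Subtype.ext
    change mk x * mk y = mk y * mk x
    rw [← map_mul, ← map_mul, QuotientGroup.mk'_apply, QuotientGroup.mk'_apply, QuotientGroup.eq,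
      Subgroup.mem_subgroupOf]
    have : (((x * y)⁻¹ * (y * x) : K) : G) = ⁅((y : K) : G)⁻¹, ((x : K) : G)⁻¹⁆ := by
      simp only [commutatorElement_def, Subgroup.coe_mul, Subgroup.coe_inv]; group
    rw [this]
    exact hcomm _ (H.inv_mem (Subgroup.mem_subgroupOf.mp hy)) _
      (H.inv_mem (Subgroup.mem_subgroupOf.mp hx))
  have htors : Monoid.IsTorsion Hq := by
    intro a
    obtain ⟨_, ⟨x, hx, rfl⟩⟩ := a
    refine isOfFinOrder_iff_pow_eq_one.mpr ⟨N, Nat.pos_of_ne_zero hN, Subtype.ext ?_⟩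
    change (mk x) ^ N = 1
    rw [← map_pow]
    exact hkerA _ (by simpa using hpow _ (Subgroup.mem_subgroupOf.mp hx))
  haveI : Finite Hq := CommGroup.finite_of_fg_torsion Hq htors
  -- hence `Kq` is finite, i.e. `A` has finite index in `K`
  haveI : Finite Kq := by
    have h := Hq.card_mul_index
    have hpos : 0 < Nat.card Hq * Hq.index := Nat.mul_pos Nat.card_pos
      (Nat.pos_of_ne_zero hHqfi.index_ne_zero)
    rw [h] at hpos
    exact Nat.finite_of_card_ne_zero hpos.ne'
  exact Subgroup.finiteIndex_of_finite_quotient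

/-! ### Closedness from a closed subgroup of finite index -/

/-- A subgroup `K` of a topological group containing a CLOSED subgroup `A` with `[K : A] < ∞` is closed
(it is a finite union of cosets `kA`). [cite: DDMSAnalyticProP1999, §1.2] -/
theorem isClosed_of_finiteIndex_subgroupOf [TopologicalSpace G] [IsTopologicalGroup G]
    (A K : Subgroup G) (hAK : A ≤ K) (hAc : IsClosed (A : Set G))
    [hfi : (A.subgroupOf K).FiniteIndex] : IsClosed (K : Set G) := by
  classical
  haveI : Finite (K ⧸ A.subgroupOf K) := Subgroup.finite_quotient_of_finiteIndex
  have hK : (K : Set G) = ⋃ c : K ⧸ A.subgroupOf K, ((c.out : K) : G) • (A : Set G) := by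
    ext x
    simp only [Set.mem_iUnion]
    constructor
    · intro hx
      refine ⟨QuotientGroup.mk (⟨x, hx⟩ : K), ?_⟩
      obtain ⟨a, ha⟩ := QuotientGroup.mk_out_eq_mul (A.subgroupOf K) (⟨x, hx⟩ : K)
      rw [ha]
      refine ⟨((a : K) : G)⁻¹, A.inv_mem (Subgroup.mem_subgroupOf.mp a.2), ?_⟩
      simp [smul_eq_mul]
    · rintro ⟨c, a, ha, rfl⟩
      exact K.mul_mem (c.out).2 (hAK ha)
  rw [hK]
  exact isClosed_iUnion_of_finite fun c => hAc.smul _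

end Literature.GroupTheory
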